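import Summits.MatrixMultiplication.MatrixMultiplication.Theorems.FarEdgeDescentExactCeiling
import Summits.MatrixMultiplication.MatrixMultiplication.Theorems.FarEdgeDescentExactDictionary
import Summits.MatrixMultiplication.MatrixMultiplication.Theorems.FarEdgeDescentFlatCorner
import HarnessLib

/-!
# Far-edge descent, kernel XXXVII-D: the squaring tower of record is a schedule — the exact ceiling recovers kernel XXXIII-B

Route `FarEdgeDescent`, special leaf `FiniteSaturation` (stmt-MatrixMultiplication-23739): helper
kernel, THESES-FREE and def-free.  NON-VACUITY / CONSISTENCY WITNESS for kernel XXXVII-B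
(`FarEdgeDescentExactCeiling.exact_ceiling`): the improvable squaring tower of the tree
(`Q + 2L = r`, `r' = r²`, `L' = (Q+L)² − Q²`, `G' = (Q^t + G)² − Q^{2t}`, base census
`G₀(s,t) ≤ L₀(1 + D(s−1))`) satisfies the schedule hypotheses of `exact_ceiling` with `a = b = j` at
every product node (via the dictionary `FarEdgeDescentExactDictionary.exact_product_step`, with
`Λ = log(1/(2λ₀²))`, `λ₀ = L₀/r₀`), so the universal exact ceiling yields the exact-level pass wedge of
kernel XXXIII-B (`FarEdgeDescentIsolatedCeiling.readout_of_wedge`) by the new route, with margin `L_j/2`: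

  `∃ c > 0: 1 ≤ s, 0 ≤ t < 1, s − 1 ≤ c(1−t)^κ ⟹ ∀ j, Q_j^t + G_j(s,t) ≤ r_j − L_j/2`

(`tower_exact_ceiling`).  The point is not the wedge (XXXIII-B has it) but that the abstract base and step
clauses of the universal theorem are literally met by the chain of record — the schedule theorem is an
honest generalisation, and any other product-and-reanchor schedule over the same bases is handled by the
same two clauses.

References: Schönhage 1981, §5; Pan 1984 (LNCS 179) §16 Props. 16.2–16.5, §17 Thm. 17.1;
Lotti–Romani 1983, Prop. 4.1; Knuth TAOCP 2, §4.6.4 Ex. 67(g).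
Tags: `FiniteSaturation` (h₁) NEC · WEAKER · ATTACKED; instance of the exact ceiling (XXXVII-B).
-/

set_option linter.dupNamespace false

noncomputable section

namespace Summit.MatrixMultiplication.MatrixMultiplication.Theorems.FarEdgeDescentExactCeilingTower

open Summit.MatrixMultiplication.MatrixMultiplication.Theorems.FarEdgeDescentImprovableRate
open Summit.MatrixMultiplication.MatrixMultiplication.Theorems.FarEdgeDescentMomentReadout
open Summit.MatrixMultiplication.MatrixMultiplication.Theorems.FarEdgeDescentAnchorTax
open Summit.MatrixMultiplication.MatrixMultiplication.Theorems.FarEdgeDescentExactSteps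
open Summit.MatrixMultiplication.MatrixMultiplication.Theorems.FarEdgeDescentExactCeiling
open Summit.MatrixMultiplication.MatrixMultiplication.Theorems.FarEdgeDescentExactDictionary
open Summit.MatrixMultiplication.MatrixMultiplication.Theorems.FarEdgeDescentFlatCorner

variable (r Q L : ℕ → ℕ) (G : ℕ → ℝ → ℝ → ℝ)

/-- **The squaring tower is a schedule; the universal exact ceiling gives its pass wedge.**  For the
improvable squaring tower of the tree with a base census linear in `s − 1`, there is `c > 0` such that
every exact readout `Q_j^t + G_j(s,t) ≤ r_j` passes — with margin `L_j/2` — whenever `1 ≤ s`, `0 ≤ t < 1`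
and `s − 1 ≤ c(1−t)^κ`, `κ = log₂(4/3)`.  Proof: the tower is the schedule `node j+1 = node j × node j`
of `exact_ceiling`, the clauses being supplied by `exact_product_step` (`Λ = log(1/(2λ₀²))`) and
`block_value_le`-type linearity of the base. [cite: Pan1984, Props. 16.2–16.5, Thm. 17.1]
[cite: Schonhage1981, §5] [cite: LottiRomani1983, Prop. 4.1] -/
theorem tower_exact_ceiling (hsum : ∀ j, Q j + 2 * L j = r j) (hQ1 : ∀ j, 1 ≤ Q j)
    (hm0 : 3 * L 0 ≤ r 0) (hL0 : 1 ≤ L 0) (hL : ∀ j, L (j + 1) = (Q j + L j) ^ 2 - Q j ^ 2)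
    (hr : ∀ j, r (j + 1) = r j ^ 2) (hG0 : ∀ s t : ℝ, 1 ≤ s → 0 ≤ G 0 s t)
    (hG : ∀ j (s t : ℝ), G (j + 1) s t = (((Q j : ℕ) : ℝ) ^ t + G j s t) ^ 2 - (((Q j : ℕ) : ℝ) ^ t) ^ 2)
    {D : ℝ} (hD : 0 ≤ D)
    (hUp : ∀ s t : ℝ, 1 ≤ s → s ≤ 2 → t ≤ 1 → G 0 s t ≤ (L 0 : ℝ) * (1 + D * (s - 1))) :
    ∃ c : ℝ, 0 < c ∧ ∀ s t : ℝ, 1 ≤ s → 0 ≤ t → t < 1 →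
      s - 1 ≤ c * (1 - t) ^ Real.logb 2 ((4 : ℝ) / 3) →
      ∀ j, ((Q j : ℕ) : ℝ) ^ t + G j s t ≤ (r j : ℝ) - (L j : ℝ) / 2 := by
  obtain ⟨hκ0, hκ1⟩ := improvableKappa_pos_lt_one
  set κ : ℝ := Real.logb 2 ((4 : ℝ) / 3) with hκ
  -- real forms of the recursion
  have hQR : ∀ j, (1 : ℝ) ≤ Q j := fun j => by exact_mod_cast hQ1 j
  have hLR : ∀ j, (1 : ℝ) ≤ L j := one_le_legs Q L hL hL0
  have eR : ∀ j, ((r j : ℕ) : ℝ) = Q j + 2 * L j := fun j => by exact_mod_cast (hsum j).symm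
  have hrpos : ∀ j, (0 : ℝ) < r j := fun j => by rw [eR]; linarith [hQR j, hLR j]
  have hr1 : ∀ j, (1 : ℝ) < r j := fun j => by rw [eR]; linarith [hQR j, hLR j]
  have er1 : ∀ j, ((r (j + 1) : ℕ) : ℝ) = ((Q j : ℝ) + 2 * L j) * ((Q j : ℝ) + 2 * L j) := fun j => by
    rw [← eR]; exact_mod_cast (by rw [hr j, sq] : r (j + 1) = r j * r j)
  have eL1 : ∀ j, ((L (j + 1) : ℕ) : ℝ) = (Q j : ℝ) * L j + (Q j : ℝ) * L j + (L j : ℝ) * L j :=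
    fun j => by rw [legs_real Q L hL j]; ring
  have eQ1 : ∀ j, ((Q (j + 1) : ℕ) : ℝ) = (Q j : ℝ) * Q j + 2 * L j * L j := fun j => by
    have h1 : ((Q (j + 1) : ℕ) : ℝ) + 2 * L (j + 1) = r (j + 1) := by exact_mod_cast hsum (j + 1)
    rw [er1, eL1] at h1
    linarith
  -- the share `λ₀ = L₀/r₀` and its bounds along the tower
  obtain ⟨l₀, hl₀⟩ : ∃ l₀ : ℝ, l₀ = (L 0 : ℝ) / (r 0 : ℝ) := ⟨_, rfl⟩
  have hl₀0 : 0 < l₀ := by rw [hl₀]; exact div_pos (by linarith [hLR 0]) (hrpos 0)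
  have hl₀3 : l₀ ≤ 1 / 3 := by
    rw [hl₀, div_le_iff₀ (hrpos 0)]
    have : (3 : ℝ) * L 0 ≤ r 0 := by exact_mod_cast hm0
    linarith
  have eLam : ∀ j, ((L (j + 1) : ℕ) : ℝ) / r (j + 1) =
      (L j : ℝ) / r j + (L j : ℝ) / r j - 3 * ((L j : ℝ) / r j) * ((L j : ℝ) / r j) := fun j => by
    have h := hrpos j
    rw [er1, eL1, eR]
    rw [eR] at h
    field_simp
    ring
  have hLam : ∀ j, l₀ ≤ (L j : ℝ) / r j ∧ (L j : ℝ) / r j ≤ 1 / 3 := by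
    intro j
    induction j with
    | zero => exact ⟨by rw [hl₀], by rw [← hl₀]; exact hl₀3⟩
    | succ j ih =>
      rw [eLam]
      exact lam_step ih.1 ih.2 (le_trans hl₀0.le ih.1) ih.2
  -- the depth threshold `Λ = log(1/(2λ₀²))`: `rr ≤ e^Λ · 2LL` along the tower
  obtain ⟨Λ, hΛ⟩ : ∃ Λ : ℝ, Λ = Real.log (1 / (2 * l₀ ^ 2)) := ⟨_, rfl⟩
  have h2l : 0 < 2 * l₀ ^ 2 := by positivity
  have hΛexp : Real.exp Λ = 1 / (2 * l₀ ^ 2) := by rw [hΛ]; exact Real.exp_log (by positivity)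
  have hΛ0 : 0 ≤ Λ := by
    rw [hΛ]
    refine Real.log_nonneg ?_
    rw [le_div_iff₀ h2l]
    nlinarith
  have hΛj : ∀ j, ((Q j : ℝ) + 2 * L j) * ((Q j : ℝ) + 2 * L j) ≤
      Real.exp Λ * (2 * (L j : ℝ) * L j) := by
    intro j
    rw [hΛexp]
    have h := (hLam j).1
    rw [eR, le_div_iff₀ (by rw [← eR]; exact hrpos j)] at h
    rw [div_mul_eq_mul_div, one_mul, le_div_iff₀ h2l]
    have hQL : 0 ≤ (Q j : ℝ) + 2 * L j := by linarith [hQR j, hLR j]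
    nlinarith [mul_le_mul h h (mul_nonneg hl₀0.le hQL) (by linarith [hLR j])]
  -- base family constants
  obtain ⟨w, hw⟩ : ∃ w : ℝ, w = (3 * l₀) ^ (1 - κ) * Real.log (r 0 : ℝ) ^ κ := ⟨_, rfl⟩
  have hlog0 : 0 < Real.log (r 0 : ℝ) := Real.log_pos (hr1 0)
  have hw0 : 0 < w := by
    rw [hw]
    exact mul_pos (Real.rpow_pos_of_pos (by linarith) _) (Real.rpow_pos_of_pos hlog0 _)
  obtain ⟨Φ₀, hΦ₀⟩ : ∃ Φ₀ : ℝ, Φ₀ = D * l₀ / w := ⟨_, rfl⟩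
  have hΦ₀0 : 0 ≤ Φ₀ := by rw [hΦ₀]; exact div_nonneg (mul_nonneg hD hl₀0.le) hw0.le
  have hΦw : Φ₀ * w = D * l₀ := by rw [hΦ₀]; field_simp
  -- the universal exact ceiling
  obtain ⟨c, hc, hcl⟩ := exact_ceiling (ℓ₁ := Real.log (r 0 : ℝ)) hl₀0 hlog0.le hΦ₀0 hΛ0
  refine ⟨min c 1, lt_min hc one_pos, ?_⟩
  intro s t h1s ht0 ht1 hst j
  have hτ0 : 0 < 1 - t := by linarith
  have hτ1 : 1 - t ≤ 1 := by linarith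
  have hτκ : (1 - t) ^ κ ≤ 1 := Real.rpow_le_one hτ0.le hτ1 hκ0.le
  have hτκ0 : 0 ≤ (1 - t) ^ κ := Real.rpow_nonneg hτ0.le _
  have hσc : s - 1 ≤ c * (1 - t) ^ κ :=
    le_trans hst (mul_le_mul_of_nonneg_right (min_le_left _ _) hτκ0)
  have hs2 : s ≤ 2 := by
    have : s - 1 ≤ 1 * (1 - t) ^ κ := le_trans hst (mul_le_mul_of_nonneg_right (min_le_right _ _) hτκ0)
    linarith
  have hGj : ∀ j, 0 ≤ G j s t := G_nonneg_at Q G hG (hG0 s t h1s)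
  -- the schedule: node `j+1 = j × j`
  have key := hcl (s - 1) (1 - t) (fun j => (L j : ℝ) / r j) (fun j => Real.log (r j : ℝ))
    (fun j => (((Q j : ℕ) : ℝ) ^ t + G j s t) / r j) (by linarith) hτ0 hτ1 hσc ?_ j
  · -- read the conclusion back
    have hrj := hrpos j
    have hrj' := hrj.ne'
    have h : (((Q j : ℕ) : ℝ) ^ t + G j s t) / r j ≤ 1 - (L j : ℝ) / r j / 2 := key
    rw [div_le_iff₀ hrj] at h
    have e : (1 - (L j : ℝ) / r j / 2) * r j = r j - L j / 2 := by field_simp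
    linarith [e]
  -- the two clauses
  intro i
  cases i with
  | zero =>
    refine Or.inl ⟨(hLam 0).1, (hLam 0).2, hlog0.le, le_rfl,
      div_nonneg (add_nonneg (Real.rpow_nonneg (Nat.cast_nonneg _) _) (hGj 0)) (hrpos 0).le, ?_⟩
    -- base: `Q₀^t ≤ Q₀`, `G₀ ≤ L₀(1 + D(s−1))`, so `F₀ ≤ 1 − λ₀ + Dλ₀(s−1)`
    have hlam0 : (L 0 : ℝ) / r 0 = l₀ := hl₀.symm
    simp only [hlam0]
    have hΦ : Φ₀ * (s - 1) * ((3 * l₀) ^ (1 - κ) * Real.log (r 0 : ℝ) ^ κ) = D * l₀ * (s - 1) := by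
      rw [← hw, mul_comm (Φ₀ * (s - 1)) w, ← mul_assoc, mul_comm w Φ₀, hΦw]
    rw [hΦ, div_le_iff₀ (hrpos 0)]
    have hQt : ((Q 0 : ℕ) : ℝ) ^ t ≤ Q 0 :=
      (Real.rpow_le_rpow_of_exponent_le (hQR 0) ht1.le).trans_eq (Real.rpow_one _)
    have hup := hUp s t h1s hs2 ht1.le
    have el : l₀ * (r 0 : ℝ) = L 0 := by rw [hl₀]; exact div_mul_cancel₀ _ (hrpos 0).ne'
    have e3 : (1 - l₀ + D * l₀ * (s - 1)) * (r 0 : ℝ) = (Q 0 : ℝ) + (L 0 : ℝ) * (1 + D * (s - 1)) := by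
      linear_combination eR 0 + (D * (s - 1) - 1) * el
    rw [e3]
    linarith [hup, hQt]
  | succ i =>
    refine Or.inr ⟨i, Nat.lt_succ_self i, i, Nat.lt_succ_self i, eLam i, ?_, ?_, ?_, ?_⟩
    · show Real.log ((r (i + 1) : ℕ) : ℝ) = Real.log (r i : ℝ) + Real.log (r i : ℝ)
      rw [er1, eR]
      exact (exact_product_step (hQR i) (hQR i) (hLR i) (hLR i) (hGj i) (hGj i) ht0 ht1.le
        (hΛj i)).2.2.1
    · show 0 ≤ (((Q (i + 1) : ℕ) : ℝ) ^ t + G (i + 1) s t) / r (i + 1)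
      exact div_nonneg (add_nonneg (Real.rpow_nonneg (Nat.cast_nonneg _) _) (hGj (i + 1)))
        (hrpos (i + 1)).le
    · show (((Q (i + 1) : ℕ) : ℝ) ^ t + G (i + 1) s t) / r (i + 1) ≤
        (((Q i : ℕ) : ℝ) ^ t + G i s t) / r i * ((((Q i : ℕ) : ℝ) ^ t + G i s t) / r i) +
          2 * ((L i : ℝ) / r i) * ((L i : ℝ) / r i)
      have eG : G (i + 1) s t = (((Q i : ℕ) : ℝ) ^ t + G i s t) * (((Q i : ℕ) : ℝ) ^ t + G i s t) -
          (((Q i : ℕ) : ℝ) * Q i) ^ t := by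
        rw [hG, Real.mul_rpow (Nat.cast_nonneg _) (Nat.cast_nonneg _)]; ring
      rw [eQ1, eG, er1, eR]
      exact (exact_product_step (hQR i) (hQR i) (hLR i) (hLR i) (hGj i) (hGj i) ht0 ht1.le
        (hΛj i)).2.2.2.2.1
    · show (((Q (i + 1) : ℕ) : ℝ) ^ t + G (i + 1) s t) / r (i + 1) ≤
        (((Q i : ℕ) : ℝ) ^ t + G i s t) / r i * ((((Q i : ℕ) : ℝ) ^ t + G i s t) / r i) +
          2 * ((L i : ℝ) / r i) * ((L i : ℝ) / r i) *
            Real.exp (-((1 - t) * (Real.log ((r (i + 1) : ℕ) : ℝ) - Λ)))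
      have eG : G (i + 1) s t = (((Q i : ℕ) : ℝ) ^ t + G i s t) * (((Q i : ℕ) : ℝ) ^ t + G i s t) -
          (((Q i : ℕ) : ℝ) * Q i) ^ t := by
        rw [hG, Real.mul_rpow (Nat.cast_nonneg _) (Nat.cast_nonneg _)]; ring
      rw [eQ1, eG, er1, eR]
      exact (exact_product_step (hQR i) (hQR i) (hLR i) (hLR i) (hGj i) (hGj i) ht0 ht1.le
        (hΛj i)).2.2.2.2.2

end Summit.MatrixMultiplication.MatrixMultiplication.Theorems.FarEdgeDescentExactCeilingTower

end
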